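import Mathlib
import Summits.MatrixMultiplication.MatrixMultiplication.Theorems.LevelGradedCohnUmansLevelOneGL2DesignsTangencyParabolaLift

/-!
# Rigidity of difference-invariant lifts over prime fields — wall-breaker axis
`parabola lifts over finite fields` for the packing stub `stub_tangencySets` of the crux
`LevelOneGL2Designs` (stmt-MatrixMultiplication-14080, route `LevelGradedCohnUmans`), k11 seat 3

Every construction of the axis (and the Hermitian unital it imitates) is a LIFT: a curve
`y = φ(x)` is thickened vertically by a set `C`, giving the points `(x, φ x + c)`, `c ∈ C`, and the
point `(x, φ x + c)` is given the line of slope `m x c` through it.  The point `(x', φ x' + c')` lies on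
the line of `(x, φ x + c)` iff the *defect* `φ x' − φ x − m x c · (x' − x)` equals `c − c'`.  What makes
the parabola `φ = x²`, `m x c = 2x` work (`…TangencyParabolaLift`: "incidence between the lifted flags
depends only on the parameters") is that its defect `(x' − x)²` depends on `x, x'` only through the
difference `x' − x`; the tangency condition then collapses to ONE condition on `C`
(`(C − C) ∩ □ = {0}`, a Paley coclique).  Over `𝔽_{q²}` the unital `Tr y = N x` has the same
property modulo the subgroup `ker Tr` (its defect is `θ·N(x' − x)` plus a trace-zero term), and that
is the mechanism every "unital substitute" over a prime field tries to reproduce.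

This file shows that over a PRIME field the mechanism has no other instance:

* `eq_mul_of_map_add` — an additive map `ZMod p → ZMod p` is `x ↦ f 1 · x` (prime field: no
  Frobenius twists, the loophole the unital uses over `𝔽_{q²}`);
* `eq_quadratic_of_defect_eq` — **rigidity**: if `p ≠ 2` and the defect of `(φ, m)` is a function of
  the difference alone, `φ (x + r) − φ x − m x c · r = D r c`, then `φ` is a quadratic polynomial
  `a x² + b x + φ 0`, the slopes are `m x c = 2a x + b − e c` and `D r c = a r² + e c · r`
  (the symmetric part of the 2-cocycle `D (x + r) − D x − D r` is bi-additive, hence `κ x r`);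
* `liftTangency_classification` — if moreover the lifted configuration is a TANGENCY configuration
  (no lifted point on another lifted point's line) and `|C| ≥ 2`, then `a ≠ 0`, every `e c = 0`
  (the lines are the true tangents of the parabolas `y = a x² + b x + φ 0 + c`) and `a⁻¹ C` is a
  Paley coclique;
* `card_sq_le_of_liftTangency` — hence `|C|² ≤ p` (`ParabolaLift.card_coclique_sq_le`), i.e. such a
  configuration has `p·|C| ≤ p^{3/2}` points and reaches the stub's `c·p^{3/2}` only through Paley
  cocliques of size `c√p` — the residual `ParabolaLift.tangencySets_of_large_cocliques` of the axis.

So "parabola lifts over 𝔽_p" is not a choice but a theorem: difference-invariant lifts ARE parabola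
pencils over Paley cocliques.  Companion classifications with the same residual: a symmetry of
order `p` (`UnipotentSymmetry.card_of_pow_prime_symmetry`), torus symmetry (`NormPencil…`,
`HermitianUnital…`).  What escapes all of them — and carries every unconditional record of the
tree (`p^{5/4}` for all primes, `p^{3/2−ε}` for all large primes, `Multiquadratic…`) — are lifts whose
defect is controlled only on a BOX (no wrap-around), where the residual is Sárközy-type and the
reach is `p^{3/2−o(1)}`, never `c·p^{3/2}` (AXIS.md of this seat).
All statements are elementary and fully proved; no definitions, no named facts.
-/

set_option linter.dupNamespace false

open Finset

namespace Summit.MatrixMultiplication.MatrixMultiplication.Theorems.LevelOneGL2Designs.LiftRigidity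

section
variable {p : ℕ} [Fact p.Prime]

/-- **Additive self-maps of a prime field are scalar.**  If `f (x + y) = f x + f y` on `ZMod p` then
`f x = f 1 · x` (induction along `ℕ → ZMod p`, which is onto).  Over `𝔽_{q²}` the Frobenius `x ↦ x^q`
is additive and not of this form — the twist behind the Hermitian unital; a prime field has none.
[elementary] -/
theorem eq_mul_of_map_add (f : ZMod p → ZMod p) (h : ∀ x y, f (x + y) = f x + f y) (x : ZMod p) :
    f x = f 1 * x := by
  have h0 : f 0 = 0 := by
    have := h 0 0
    rw [add_zero] at this
    linear_combination -this
  have hn : ∀ n : ℕ, f n = f 1 * n := by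
    intro n
    induction n with
    | zero => simp [h0]
    | succ n ih => rw [Nat.cast_succ, h, ih]; ring
  obtain ⟨n, rfl⟩ := ZMod.natCast_zmod_surjective x
  exact hn n

/-- **Rigidity of difference-invariant lifts.**  Let `p ≠ 2` and `φ : ZMod p → ZMod p` (the curve),
`m : ZMod p → ZMod p → ZMod p` (the slope given to the point over `x` on the sheet `c`) and
`D : ZMod p → ZMod p → ZMod p` be such that the defect depends on the base point only through the
difference: `φ (x + r) − φ x − m x c · r = D r c` for all `x r c`.  Then there are `a b : ZMod p` and
`e : ZMod p → ZMod p` with `φ x = a x² + b x + φ 0`, `m x c = 2a x + b − e c`, `D r c = a r² + e c · r`: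
the curve is a parabola (or a line) and the lines are tangents shifted by a slope constant on each
sheet.  Proof: `D (x + r) c − D x c − D r c = (m x c − m 0 c)·r` is symmetric in `x, r`, so
`m x c − m 0 c = κ x`; then `2·D x c − κ x²` is additive, hence linear (`eq_mul_of_map_add`).
[elementary] -/
theorem eq_quadratic_of_defect_eq (hp2 : p ≠ 2) (φ : ZMod p → ZMod p) (m D : ZMod p → ZMod p → ZMod p)
    (h : ∀ x r c, φ (x + r) - φ x - m x c * r = D r c) :
    ∃ (a b : ZMod p) (e : ZMod p → ZMod p), (∀ x, φ x = a * x ^ 2 + b * x + φ 0) ∧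
      (∀ x c, m x c = 2 * a * x + b - e c) ∧ (∀ r c, D r c = a * r ^ 2 + e c * r) := by
  have h2 : (2 : ZMod p) ≠ 0 := by
    intro h0
    have h' : ((2 : ℕ) : ZMod p) = 0 := by exact_mod_cast h0
    rw [ZMod.natCast_eq_zero_iff] at h'
    rcases (Nat.Prime.eq_one_or_self_of_dvd Nat.prime_two p h') with h1 | h1
    · exact (Fact.out : p.Prime).one_lt.ne' h1
    · exact hp2 h1
  obtain ⟨t, ht⟩ : ∃ t : ZMod p, 2 * t = 1 := ⟨2⁻¹, mul_inv_cancel₀ h2⟩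
  -- the defect from the origin
  have hD : ∀ r c, D r c = φ r - φ 0 - m 0 c * r := fun r c => by rw [← h 0 r c, zero_add]
  -- the 2-cocycle identity
  have hcoc : ∀ x r c, D (x + r) c - D x c - D r c = (m x c - m 0 c) * r := by
    intro x r c
    have hx := h x r c
    rw [hD] at hx
    rw [hD (x + r), hD x, hD r]
    linear_combination hx
  -- symmetry of the cocycle: the slopes are linear in the base point
  set κ : ZMod p → ZMod p := fun c => m 1 c - m 0 c with hκ
  have hm : ∀ x c, m x c - m 0 c = κ c * x := by
    intro x c
    have h1 := hcoc x 1 c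
    have h1' := hcoc 1 x c
    rw [add_comm] at h1'
    have : (m x c - m 0 c) * 1 = (m 1 c - m 0 c) * x := by rw [← h1, ← h1']; ring
    simpa [hκ] using this
  -- `2·D x c − κ c · x²` is additive in `x`, hence linear
  have hE : ∀ c x y, (2 * D (x + y) c - κ c * (x + y) ^ 2) =
      (2 * D x c - κ c * x ^ 2) + (2 * D y c - κ c * y ^ 2) := by
    intro c x y
    have hc := hcoc x y c
    rw [hm x c] at hc
    linear_combination 2 * hc
  set ε : ZMod p → ZMod p := fun c => 2 * D 1 c - κ c * 1 ^ 2 with hε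
  have hDform : ∀ r c, 2 * D r c = κ c * r ^ 2 + ε c * r := by
    intro r c
    have := eq_mul_of_map_add (fun x => 2 * D x c - κ c * x ^ 2) (hE c) r
    beta_reduce at this
    simp only [hε]
    linear_combination this
  have hφform : ∀ x c, 2 * φ x = κ c * x ^ 2 + (ε c + 2 * m 0 c) * x + 2 * φ 0 := by
    intro x c
    linear_combination hDform x c - 2 * hD x c
  -- the coefficients do not depend on the sheet: compare with the sheet `0` at `x = ±1`
  have hcoef : ∀ c, κ c = κ 0 ∧ ε c + 2 * m 0 c = ε 0 + 2 * m 0 0 := by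
    intro c
    have e1 := hφform 1 c
    have e1' := hφform 1 0
    have e2 := hφform (-1) c
    have e2' := hφform (-1) 0
    have hk2 : (2 : ZMod p) * (κ c - κ 0) = 0 := by linear_combination e1' - e1 + (e2' - e2)
    have hl2 : (2 : ZMod p) * ((ε c + 2 * m 0 c) - (ε 0 + 2 * m 0 0)) = 0 := by
      linear_combination e1' - e1 - (e2' - e2)
    exact ⟨sub_eq_zero.mp ((mul_eq_zero.mp hk2).resolve_left h2),
      sub_eq_zero.mp ((mul_eq_zero.mp hl2).resolve_left h2)⟩
  refine ⟨κ 0 * t, (ε 0 + 2 * m 0 0) * t, fun c => ε c * t, ?_, ?_, ?_⟩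
  · intro x
    linear_combination t * hφform x 0 + (φ 0 - φ x) * ht
  · intro x c
    obtain ⟨hk, hl⟩ := hcoef c
    linear_combination hm x c + x * hk + t * hl - (κ 0 * x + m 0 c) * ht
  · intro r c
    obtain ⟨hk, -⟩ := hcoef c
    linear_combination t * hDform r c + (t * r ^ 2) * hk - (D r c) * ht

/-- **Classification of difference-invariant lift tangency configurations.**  `p ≠ 2`; curve `φ`,
slopes `m x c`, sheets `c ∈ C` as in `eq_quadratic_of_defect_eq` (defect a function `D r c` of the
difference `r = x' − x`), and TANGENCY: the point `(x', φ x' + c')` lies on the line of slope `m x c`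
through `(x, φ x + c)` only if it is that point.  If `C` has two elements then the configuration is
a pencil of parabolas `y = a x² + b x + φ 0 + c` (`a ≠ 0`) with their true tangents (`m x c = 2a x + b`)
over a set `C` such that `a⁻¹·(c − c')` is a non-square for all `c ≠ c'` in `C` — a dilated Paley
coclique.  (With `|C| ≤ 1` lines and shifted tangents also occur.) [elementary] -/
theorem liftTangency_classification (hp2 : p ≠ 2) (φ : ZMod p → ZMod p)
    (m D : ZMod p → ZMod p → ZMod p) (C : Finset (ZMod p))
    (h : ∀ x r c, φ (x + r) - φ x - m x c * r = D r c)
    (hT : ∀ x x' : ZMod p, ∀ c ∈ C, ∀ c' ∈ C,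
      (φ x' + c') - (φ x + c) = m x c * (x' - x) → x' = x ∧ c' = c)
    (hC : 1 < C.card) :
    ∃ a b : ZMod p, a ≠ 0 ∧ (∀ x, φ x = a * x ^ 2 + b * x + φ 0) ∧ (∀ x, ∀ c ∈ C, m x c = 2 * a * x + b) ∧
      ∀ c ∈ C, ∀ c' ∈ C, c ≠ c' → ¬ IsSquare (a⁻¹ * (c - c')) := by
  obtain ⟨a, b, e, hφ, hm, hD⟩ := eq_quadratic_of_defect_eq hp2 φ m D h
  -- incidence in coordinates: `(x + r, ·, c')` is on the line of `(x, ·, c)` iff `D r c = c' - c`... with signs: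
  have hinc : ∀ x r : ZMod p, ∀ c ∈ C, ∀ c' ∈ C, a * r ^ 2 + e c * r = c - c' → r = 0 ∧ c' = c := by
    intro x r c hc c' hc' hr
    have key := hT x (x + r) c hc c' hc' ?_
    · exact ⟨by linear_combination key.1, key.2⟩
    · have := h x r c
      rw [hD] at this
      linear_combination this + hr
  obtain ⟨c₁, hc₁, c₂, hc₂, hne⟩ := Finset.one_lt_card.mp hC
  -- `a ≠ 0`: otherwise `e c₁ · r` is `0` (take `r = 1`, contradiction with `r = 0`) or onto (hits `c₁ - c₂`)
  have ha : a ≠ 0 := by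
    intro ha
    by_cases he : e c₁ = 0
    · have := (hinc 0 1 c₁ hc₁ c₁ hc₁ (by rw [ha, he]; ring)).1
      exact one_ne_zero this
    · have := (hinc 0 ((c₁ - c₂) * (e c₁)⁻¹) c₁ hc₁ c₂ hc₂
        (by rw [ha, zero_mul, zero_add, mul_comm (e c₁), mul_assoc, inv_mul_cancel₀ he, mul_one])).2
      exact hne this.symm
  -- `e c = 0` on `C`: otherwise `r = -e c / a ≠ 0` gives defect `0 = c - c`
  have he : ∀ c ∈ C, e c = 0 := by
    intro c hc
    by_contra hec
    have := (hinc 0 (-(e c) * a⁻¹) c hc c hc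
      (by linear_combination ((e c) ^ 2 * a⁻¹) * mul_inv_cancel₀ ha)).1
    rw [neg_mul, neg_eq_zero, mul_eq_zero] at this
    exact this.elim hec (inv_ne_zero ha)
  refine ⟨a, b, ha, hφ, fun x c hc => by rw [hm, he c hc, sub_zero], ?_⟩
  rintro c hc c' hc' hcc ⟨s, hs⟩
  have hs' : c - c' = a * (s * s) := by rw [← hs, ← mul_assoc, mul_inv_cancel₀ ha, one_mul]
  exact hcc (hinc 0 s c hc c' hc' (by rw [he c hc]; linear_combination -hs')).2.symm

/-- **Corollary: `|C|² ≤ p`.**  A difference-invariant lift tangency configuration over `ZMod p`,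
`p ≠ 2`, has at most `√p` sheets, hence at most `p^{3/2}` points; and (by the classification) it has
`c·√p` sheets only if a Paley coclique of that size exists.  [elementary; uses
`ParabolaLift.card_coclique_sq_le`] -/
theorem card_sq_le_of_liftTangency (hp2 : p ≠ 2) (φ : ZMod p → ZMod p)
    (m D : ZMod p → ZMod p → ZMod p) (C : Finset (ZMod p))
    (h : ∀ x r c, φ (x + r) - φ x - m x c * r = D r c)
    (hT : ∀ x x' : ZMod p, ∀ c ∈ C, ∀ c' ∈ C,
      (φ x' + c') - (φ x + c) = m x c * (x' - x) → x' = x ∧ c' = c) :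
    C.card * C.card ≤ p := by
  classical
  by_cases hC : 1 < C.card
  · obtain ⟨a, b, ha, -, -, hco⟩ := liftTangency_classification hp2 φ m D C h hT hC
    have hI : ∀ x ∈ C.image (a⁻¹ * ·), ∀ y ∈ C.image (a⁻¹ * ·), x ≠ y → ¬ IsSquare (x - y) := by
      simp only [mem_image]
      rintro _ ⟨c, hc, rfl⟩ _ ⟨c', hc', rfl⟩ hne
      rw [← mul_sub]
      exact hco c hc c' hc' fun hcc => hne (by rw [hcc])
    have := ParabolaLift.card_coclique_sq_le (C.image (a⁻¹ * ·)) hI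
    rwa [card_image_of_injective _ (mul_right_injective₀ (inv_ne_zero ha))] at this
  · have h1 : C.card ≤ 1 := not_lt.mp hC
    calc C.card * C.card ≤ 1 * 1 := Nat.mul_le_mul h1 h1
      _ ≤ p := by simpa using (Fact.out : p.Prime).one_lt.le

end

/-- **Registered form (stub `liftRigidity_paley` of stmt-MatrixMultiplication-14080): difference-invariant
lifts over a prime field are parabola pencils over Paley cocliques.**  For a prime `p ≠ 2`, a curve
`φ : ZMod p → ZMod p`, slopes `m x c` and sheets `c ∈ C ⊆ ZMod p` such that (i) the defect
`φ (x + r) − φ x − m x c · r` is a function `D r c` of the difference `r` alone (the lift principle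
behind the parabola pencil and, modulo `ker Tr`, behind the Hermitian unital) and (ii) the lifted
points `(x, φ x + c)` with their lines of slope `m x c` form a tangency configuration (no lifted
point on another's line): `|C|² ≤ p`, and as soon as `|C| ≥ 2` the curve is a parabola
`a x² + b x + φ 0` (`a ≠ 0`), the lines are its true tangents on every sheet, and `a⁻¹·C` is a
Paley coclique.  Hence this mechanism yields the stub's `c·p^{3/2}` points (`= p·|C|`) only via
Paley cocliques of size `c·√p` (`ParabolaLift.tangencySets_of_large_cocliques`), which exist for
no known prime. [elementary; this file] -/
theorem liftRigidity_paley {p : ℕ} [Fact p.Prime] (hp2 : p ≠ 2) (φ : ZMod p → ZMod p)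
    (m D : ZMod p → ZMod p → ZMod p) (C : Finset (ZMod p))
    (h : ∀ x r c, φ (x + r) - φ x - m x c * r = D r c)
    (hT : ∀ x x' : ZMod p, ∀ c ∈ C, ∀ c' ∈ C,
      (φ x' + c') - (φ x + c) = m x c * (x' - x) → x' = x ∧ c' = c) :
    C.card * C.card ≤ p ∧ (1 < C.card → ∃ a b : ZMod p, a ≠ 0 ∧
      (∀ x, φ x = a * x ^ 2 + b * x + φ 0) ∧ (∀ x, ∀ c ∈ C, m x c = 2 * a * x + b) ∧
      ∀ c ∈ C, ∀ c' ∈ C, c ≠ c' → ¬ IsSquare (a⁻¹ * (c - c'))) :=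
  ⟨card_sq_le_of_liftTangency hp2 φ m D C h hT,
    fun hC => liftTangency_classification hp2 φ m D C h hT hC⟩

end Summit.MatrixMultiplication.MatrixMultiplication.Theorems.LevelOneGL2Designs.LiftRigidity
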